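import Summits.BirchSwinnertonDyer.BirchSwinnertonDyer.Theorems.GenusKolyvaginAtTwoTorsionCellSELTwistClasses
import HarnessLib

/-!
# SEL (iso-class Selmer pair law), V-c: the row system of a Selmer class with torsion-times-support components

Crux R″ `RankOneTwoTorsionResidualAtTwo` (stmt-27478), LINE 49 «full_vertex», SUPPORT stub SEL
`IsoClassSelmerPairLawAtTwo`, `C₀` half.  Setting of parts II–IV.  Part III shows that a Selmer class of the iso-class
twist `E^{(M)}` has components `([t₁ ∏_{Q_a} i], [t₂ ∏_{Q_b} i])` for a torsion pair `(t₁, t₂)` of `E` and EVEN `Q`-supports;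
here we read the `I₀*` relations at the primes of `Q` on such components:

* **`rows_of_torsion_mul_support_components`** — if `c ∈ Sel⁽²⁾(E^{(M)}/ℚ)` has components
  `([t₁ ∏_{Q_a} i], [t₂ ∏_{Q_b} i])` with `t₁, t₂` units at `Q` of constant residue bits `τ₁, τ₂` and `Q_a, Q_b ⊆ Q` even,
  then the indicator vectors of `Q_a, Q_b` solve the ROW SYSTEM with right-hand sides `τ₁, τ₂`
  (`Σ_{i≠j}[−i/j]p_a(i) + (g_j+ε)p_a(j) + p_b(j) = τ₁`, `Σ_{i≠j}[−i/j]p_b(i) + (g_j+ε+1)p_b(j) + p_a(j) = τ₂`).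

This is the exact converse of part IV; together they identify `Sel⁽²⁾(E^{(M)}/ℚ)` with the torsion-indexed solutions of
the row system, which part V-d counts.  Everything is proved; no LINE 49 statement is restated; BSD is not advanced by
this file alone.

## References

* [SilvermanAEC2009] J. H. Silverman, *The Arithmetic of Elliptic Curves*, 2nd ed., Prop. X.1.4, Prop. X.4.9.
* [MazurRubin2010] B. Mazur, K. Rubin, Invent. Math. 181 (2010), Lemma 2.10, Lemma 2.11.
* [Kane2013SelmerTwists] D. M. Kane, Algebra Number Theory 7 (2013), §2.
-/

noncomputable section

open scoped Classical

namespace Summit.BirchSwinnertonDyer.BirchSwinnertonDyer.Theorems.GenusKolyvaginAtTwo.TorsionCellSEL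

open WeierstrassCurve WeierstrassCurve.Affine WeierstrassCurve.Affine.Point
open Literature.NumberTheory.GaloisRepresentations Literature.NumberTheory.EllipticCurves Field
open Literature.NumberTheory.EllipticCurves.TwoDescentLocal
open Literature.NumberTheory.EllipticCurves.KramerTwoDescent
open Summit.BirchSwinnertonDyer.BirchSwinnertonDyer.Theorems.GenusKolyvaginAtTwo.TorsionCellD0
open IsDedekindDomain NumberField Rat.HeightOneSpectrum

section Rows

variable (E : WeierstrassCurve ℚ) [E.IsElliptic] {e₁ e₂ e₃ : ℚ} (S Q : Finset ℕ)

/-- The cardinality of `R∖j` in `𝔽₂` for `R` of even size is the membership bit `[j ∈ R]`. [folklore] -/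
private theorem card_erase_cast_eq_ite {R : Finset ℕ} (hRk : Even R.card) (j : ℕ) :
    ((R.erase j).card : ZMod 2) = (if j ∈ R then 1 else 0) := by
  obtain ⟨r, hr⟩ := hRk
  by_cases hjR : j ∈ R
  · rw [if_pos hjR, Finset.card_erase_of_mem hjR]
    have hpos : 0 < R.card := Finset.card_pos.mpr ⟨j, hjR⟩
    have : R.card - 1 = 2 * (r - 1) + 1 := by omega
    rw [this, Nat.cast_add, Nat.cast_mul, show ((2 : ℕ) : ZMod 2) = 0 by decide, zero_mul, zero_add, Nat.cast_one]
  · rw [if_neg hjR, Finset.erase_eq_of_notMem hjR, hr, ← two_mul, Nat.cast_mul, show ((2 : ℕ) : ZMod 2) = 0 by decide,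
      zero_mul]

/-- **The residue bit of an even sub-product at a row prime, in indicator form**: for `R ⊆ Q` of even size and `j ∈ Q`,
`qr_j(∏_{i∈R} i) = [j ∈ R] + Σ_{i∈Q∖j} [−i/j]·[i ∈ R]`. [cite: HeathBrown1994SelmerCongruentII, §2] -/
theorem qrBit_prod_eq_ite_add_sum {j : ℕ} [Fact j.Prime] (hQ : ∀ q ∈ Q, q.Prime) (hj4 : j % 4 = 3)
    {R : Finset ℕ} (hR : R ⊆ Q) (hRk : Even R.card) :
    qrBit j (∏ i ∈ R, (i : ℚ)) = (if j ∈ R then 1 else 0) +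
      ∑ i ∈ Q.erase j, (if jacobiSym (-(i : ℤ)) j = -1 then (1 : ZMod 2) else 0) * (if i ∈ R then 1 else 0) := by
  rw [qrBit_prod_natCast_eq Q hQ hj4 hR, card_erase_cast_eq_ite hRk]
  congr 1
  have hset : (Q.erase j).filter (· ∈ R) = R.erase j := by
    ext i; simp only [Finset.mem_filter, Finset.mem_erase]
    constructor
    · rintro ⟨⟨hij, -⟩, hiR⟩; exact ⟨hij, hiR⟩
    · rintro ⟨hij, hiR⟩; exact ⟨⟨hij, hR hiR⟩, hiR⟩
  rw [← hset, Finset.sum_filter]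
  refine Finset.sum_congr rfl fun i _ => ?_
  split_ifs <;> simp

/-- **The row system of a Selmer class of the iso-class twist with torsion-times-support components.**  Setting of the
module docstring: if `c ∈ Sel⁽²⁾(E^{(M)}/ℚ)` has components `([t₁ ∏_{Q_a} i], [t₂ ∏_{Q_b} i])` with `t₁, t₂` units at the
primes of `Q` of constant residue bits `τ₁, τ₂`, and `Q_a, Q_b ⊆ Q` of even size, then the indicator vectors of `Q_a`,
`Q_b` solve the row system with right-hand sides `τ₁, τ₂`.
[cite: SilvermanAEC2009, Prop. X.1.4, Prop. X.4.9] [cite: MazurRubin2010, Lemma 2.10, Lemma 2.11] [cite: Kane2013SelmerTwists, §2] -/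
theorem rows_of_torsion_mul_support_components (h : E.toAffine.SplitTwoTorsion e₁ e₂ e₃)
    (hgood : ∀ ℓ : ℕ, (hℓ : ℓ.Prime) → ℓ ∉ S → haveI : Fact ℓ.Prime := ⟨hℓ⟩;
      padicValRat ℓ (e₁ - e₂) = 0 ∧ padicValRat ℓ (e₁ - e₃) = 0 ∧ padicValRat ℓ (e₂ - e₃) = 0)
    (hQ : ∀ q ∈ Q, q.Prime) (hQS : ∀ q ∈ Q, q ∉ S) (hQ4 : ∀ q ∈ Q, q % 4 = 3) (hk : Even Q.card)
    (hadm : ∀ q ∈ Q, (hq : q.Prime) → haveI : Fact q.Prime := ⟨hq⟩;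
      qrBit q ((e₁ - e₂) * (e₁ - e₃)) = 1 ∧ qrBit q ((e₂ - e₁) * (e₂ - e₃)) = 1)
    {ε : ZMod 2} (hε : ∀ q ∈ Q, (hq : q.Prime) → haveI : Fact q.Prime := ⟨hq⟩; qrBit q (e₂ - e₁) = ε)
    {d : ℚ} (hd : d = ∏ q ∈ Q, (q : ℚ)) [(E.quadraticTwist d).IsElliptic]
    {c : galH1Torsion (E.quadraticTwist d) 2} (hc : c ∈ selmerGroup (E.quadraticTwist d) 2)
    {t₁ t₂ : ℚˣ} {τ₁ τ₂ : ZMod 2}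
    (hτ : ∀ q ∈ Q, (hq : q.Prime) → haveI : Fact q.Prime := ⟨hq⟩;
      parityBit q (t₁ : ℚ) = 0 ∧ parityBit q (t₂ : ℚ) = 0 ∧ qrBit q (t₁ : ℚ) = τ₁ ∧ qrBit q (t₂ : ℚ) = τ₂)
    {Qa Qb : Finset ℕ} (hQa : Qa ⊆ Q) (hQb : Qb ⊆ Q) (hQak : Even Qa.card) (hQbk : Even Qb.card)
    (hpa0 : ∏ i ∈ Qa, (i : ℚ) ≠ 0) (hpb0 : ∏ i ∈ Qb, (i : ℚ) ≠ 0)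
    (ha : kummerEquiv ℚ 2 ((E.quadraticTwist d).twoTorsionCharH1 (h.quadraticTwist d) c) =
      Additive.ofMul (QuotientGroup.mk (t₁ * Units.mk0 _ hpa0)))
    (hb : kummerEquiv ℚ 2 ((E.quadraticTwist d).twoTorsionCharH1 (h.quadraticTwist d).swap₁₂ c) =
      Additive.ofMul (QuotientGroup.mk (t₂ * Units.mk0 _ hpb0))) :
    ∀ j ∈ Q,
      ((∑ i ∈ Q.erase j, (if jacobiSym (-(i : ℤ)) j = -1 then (1 : ZMod 2) else 0) * (if i ∈ Qa then 1 else 0)) +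
          ((∑ i ∈ Q.erase j, (if jacobiSym (-(i : ℤ)) j = -1 then (1 : ZMod 2) else 0)) + ε) * (if j ∈ Qa then 1 else 0) +
          (if j ∈ Qb then 1 else 0) = τ₁) ∧
      ((∑ i ∈ Q.erase j, (if jacobiSym (-(i : ℤ)) j = -1 then (1 : ZMod 2) else 0) * (if i ∈ Qb then 1 else 0)) +
          ((∑ i ∈ Q.erase j, (if jacobiSym (-(i : ℤ)) j = -1 then (1 : ZMod 2) else 0)) + ε + 1) * (if j ∈ Qb then 1 else 0) +
          (if j ∈ Qa then 1 else 0) = τ₂) := by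
  intro j hjQ
  haveI : Fact j.Prime := ⟨hQ j hjQ⟩
  have hjS : j ∉ S := hQS j hjQ
  obtain ⟨g12, g13, g23⟩ := hgood j (hQ j hjQ) hjS
  obtain ⟨hpt₁, hpt₂, hτ₁, hτ₂⟩ := hτ j hjQ (hQ j hjQ)
  obtain ⟨hδ₁, hδ₂⟩ := hadm j hjQ (hQ j hjQ)
  have hεj := hε j hjQ (hQ j hjQ)
  have he21 : e₂ - e₁ ≠ 0 := sub_ne_zero.mpr h.ne₁₂.symm
  have hm1 : qrBit j (-1 : ℚ) = 1 := qrBit_neg_one_eq_one_of_emod_four (hQ4 j hjQ)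
  have hvd : padicValRat j d = 1 := by rw [hd, padicValRat_prod_primes hQ j, if_pos hjQ]
  -- the `I₀*` relations for the representatives `(t₁ ∏_{Q_a}, t₂ ∏_{Q_b})`
  obtain ⟨r1, r2⟩ := E.qrBit_rel_quadraticTwist_of_mem_selmerGroup h hvd g12 g13 g23 hc _ _ ha hb
  -- symbols entering the relations
  have hcard : ((Q.erase j).card : ZMod 2) = 1 := by
    rw [card_erase_cast_eq_ite hk, if_pos hjQ]
  have hqd : qrBit j d = 1 + ∑ i ∈ Q.erase j, (if jacobiSym (-(i : ℤ)) j = -1 then (1 : ZMod 2) else 0) := by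
    rw [hd, qrBit_prod_natCast_eq Q hQ (hQ4 j hjQ) (subset_refl Q), hcard]
  have hq12 : qrBit j (e₁ - e₂) = 1 + ε := by rw [← neg_sub, qrBit_neg (p := j) he21, hm1, hεj]
  have hQa_p : ∀ i ∈ Qa, i.Prime := fun i hi => hQ i (hQa hi)
  have hQb_p : ∀ i ∈ Qb, i.Prime := fun i hi => hQ i (hQb hi)
  have hpA : parityBit j ((t₁ : ℚ) * ∏ i ∈ Qa, (i : ℚ)) = (if j ∈ Qa then 1 else 0) := by
    rw [parityBit_mul t₁.ne_zero hpa0, hpt₁, parityBit_prod_primes hQa_p j, zero_add]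
  have hpB : parityBit j ((t₂ : ℚ) * ∏ i ∈ Qb, (i : ℚ)) = (if j ∈ Qb then 1 else 0) := by
    rw [parityBit_mul t₂.ne_zero hpb0, hpt₂, parityBit_prod_primes hQb_p j, zero_add]
  have hrA : qrBit j ((t₁ : ℚ) * ∏ i ∈ Qa, (i : ℚ)) = τ₁ + ((if j ∈ Qa then 1 else 0) +
      ∑ i ∈ Q.erase j, (if jacobiSym (-(i : ℤ)) j = -1 then (1 : ZMod 2) else 0) * (if i ∈ Qa then 1 else 0)) := by
    rw [qrBit_mul j t₁.ne_zero hpa0, hτ₁, qrBit_prod_eq_ite_add_sum Q hQ (hQ4 j hjQ) hQa hQak]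
  have hrB : qrBit j ((t₂ : ℚ) * ∏ i ∈ Qb, (i : ℚ)) = τ₂ + ((if j ∈ Qb then 1 else 0) +
      ∑ i ∈ Q.erase j, (if jacobiSym (-(i : ℤ)) j = -1 then (1 : ZMod 2) else 0) * (if i ∈ Qb then 1 else 0)) := by
    rw [qrBit_mul j t₂.ne_zero hpb0, hτ₂, qrBit_prod_eq_ite_add_sum Q hQ (hQ4 j hjQ) hQb hQbk]
  rw [Units.val_mul, Units.val_mk0] at r1 r2
  rw [Units.val_mul, Units.val_mk0] at r1 r2
  rw [hrA, hpA, hpB, hqd, hεj, hδ₁] at r1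
  rw [hrB, hpA, hpB, hqd, hq12, hδ₂] at r2
  constructor
  · linear_combination (norm := skip) r1
    ring_nf
    try reduce_mod_char
    try simp
  · linear_combination (norm := skip) r2
    ring_nf
    try reduce_mod_char
    try simp

end Rows

end Summit.BirchSwinnertonDyer.BirchSwinnertonDyer.Theorems.GenusKolyvaginAtTwo.TorsionCellSEL

end
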